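import Summits.BirchSwinnertonDyer.BirchSwinnertonDyer.Theorems.ClassRecordThreeEulerHalvesAtThreeWalkSupplyTransverse
import Summits.BirchSwinnertonDyer.BirchSwinnertonDyer.Theorems.Rank1ResidualJetKolyvaginClassLocal
import Summits.BirchSwinnertonDyer.BirchSwinnertonDyer.Theorems.ErratumRoadFiveNonSurjCornerKolyJLevelOneAvatar
import Summits.BirchSwinnertonDyer.BirchSwinnertonDyer.Theorems.ErratumRoadFiveNonSurjCornerKolyJLevelTransport
import Summits.BirchSwinnertonDyer.BirchSwinnertonDyer.Theorems.Rank1ResidualJetSignedDualityRelaxed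
import Literature.NumberTheory.EllipticCurves.HeegnerPointsOfConductorRationalityProofs
import Literature.NumberTheory.EllipticCurves.RingClassGalOverCyclicProofs
import HarnessLib

/-!
# The supply's Selmer-membership conjuncts `hselmer` (classes of the `p^u`-th ROOTS of `P_s` lie in
# `H_{𝓕(s)}`) and `hsel0` (`c_k(sℓ) ∈ H_{𝓕₀(s)^λ}`) for the GLOBAL transverse family, from [GZ86 III
# (3.1)] in the receptacle form, the transverse condition of the root classes, and the stringent
# membership at the carrier (cell `bsd-stepL`, seat `bsd-stepL-tam3-p1`, helper toward item 19109
# `EulerHalvesAtThree`, registered stub `stub_supplyAtThree`)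

HONEST FRAMING. Nothing here proves BSD, J₃ or any divisibility of a Heegner point; no stub is
discharged; no item closes; 0 classes move (T7); `--supports stmt-BirchSwinnertonDyer-19109` (helper).

WHAT THIS FILE DOES. Place by place:
* KUMMER places (every place of `K` not over a prime of the conductor): for the class `c_k(s)` of the
  derived point this is bsd-jet's `JET.localization_kolyvaginClass_mem_kummerSelmerStructure_of_GZ31`
  (p498536; Gross Prop. 6.2 (1) from [GZ86 III (3.1)], the two Gross §3 CM facts PROVED in the tree).
  For the ROOT class `κ̃ = c_k(Q)`, `p^u Q = P_s` ([J] §3.1 item 7) the same follows by the change of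
  level: `ι_* c_k(Q) = c_{k+u}(P_s)` (corner-p1's `torsionH1OfDvd_kolyvaginClass_of_zsmul`, p516360 —
  the SAME cocycle) and the local Kummer kernel is cartesian under `ι_*`
  (`mem_selmerLocalKer_iff_torsionH1OfDvd_mem`, p517404's sibling), so `c_k(Q)` is Kummer at `v` iff
  `c_{k+u}(P_s)` is (`localization_rootClass_mem_kummer`).
* TRANSVERSE places (over the primes of `s`): the global family agrees there with lit-ty's
  `transverseKer` (`globalTransverse_mem_iff`, p520448); the membership of the (root) classes in
  `transverseKer` is a HYPOTHESIS (bsd-jet's completion-layer gap `htr`, Howard 2004 Lemma 2.7.3, here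
  for root classes: `u = 0` is their `htr`).
* CARRIER places (for `hsel0`): membership in the stringent family `𝒮` is a HYPOTHESIS (bsd-jet's gap
  `h49str`, Jetchev Prop. 4.9 proper; in the degenerate Kummer carrier it is the Kummer case).
* the RELAXED place `λ` (for `hsel0`): no condition; `λ` is the only place over the inert `ℓ`.
RESULTS: `rootClass_mem_selmerGroup_selmerF` (the conjunct `hselmer` at one conductor and one root) and
`kolyvaginClass_mem_selmerGroup_selmerF0_relaxedAt` (the conjunct `hsel0` at one pair `(s, sℓ)`).
References (locators only; no cited FACT is declared): [cite: Jetchev2008, §3.1 item 7 (p. 817),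
Prop. 4.5–4.6, Prop. 4.9 (pp. 819–820)] [cite: GrossLMS1991, §6 Prop. 6.2 (1), §4 (4.4)–(4.6)]
[cite: GrossZagier1986, III (3.1)] [cite: McCallumLMS1991, §4 Lemma 4.1, (6), Lemma 4.6]
[cite: Howard2004HeegnerKolyvagin, Lemma 2.7.3]. Design: no definitions; `K : Type`. Axioms:
`propext`, `Classical.choice`, `Quot.sound`.
-/

set_option autoImplicit false

noncomputable section

open scoped Classical Pointwise
open Function NumberField IsDedekindDomain WeierstrassCurve Field
open Literature.NumberTheory.EllipticCurves Literature.NumberTheory.GaloisRepresentations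
open Literature.NumberTheory.EllipticCurves.Jetchev2008 Literature.NumberTheory.EllipticCurves.KolyvaginCocycle
open Literature.NumberTheory.EllipticCurves.ModularForms
open Literature.NumberTheory.GaloisCohomology Literature.NumberTheory.Automorphic
open Literature.NumberTheory.GaloisRepresentations.DiscreteGaloisModule (transverseSubgroup SelmerStructure)
open Summit.BirchSwinnertonDyer.Rank1Residual.JET.SelmerVocabulary
open Summit.BirchSwinnertonDyer.Rank1Residual.JET.GlobalDuality
open Summit.BirchSwinnertonDyer.Rank1Residual.X11b

namespace Summit.BirchSwinnertonDyer.Rank1Residual.JET.Walk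

variable {K : Type} [Field K] [NumberField K] (W : WeierstrassCurve ℚ) [W.IsElliptic]
  [W.IsGloballyMinimal] [NeZero (W.conductorNorm ℤ)]

omit [W.IsElliptic] [W.IsGloballyMinimal] [NeZero (W.conductorNorm ℤ)] in
/-- The prime of `K` above an INERT rational prime is unique: if `(ℓ) ⊂ 𝓞 K` is prime (`ℓ ≠ 0`), any
two places containing `ℓ` coincide. [cite: Jetchev2008, §3.1.2 (p. 814)] -/
theorem place_eq_of_natCast_mem_of_isPrime {ℓ : ℕ} (hℓ : ℓ ≠ 0)
    (hprime : (Ideal.span {(ℓ : 𝓞 K)}).IsPrime) (v w : HeightOneSpectrum (𝓞 K))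
    (hv : (ℓ : 𝓞 K) ∈ v.asIdeal) (hw : (ℓ : 𝓞 K) ∈ w.asIdeal) : v = w := by
  have hne : Ideal.span {(ℓ : 𝓞 K)} ≠ ⊥ := by
    rw [Ne, Ideal.span_singleton_eq_bot]; exact_mod_cast hℓ
  have hmax : (Ideal.span {(ℓ : 𝓞 K)}).IsMaximal := hprime.isMaximal hne
  have h1 : Ideal.span {(ℓ : 𝓞 K)} = v.asIdeal :=
    hmax.eq_of_le v.isPrime.ne_top ((Ideal.span_singleton_le_iff_mem _).mpr hv)
  have h2 : Ideal.span {(ℓ : 𝓞 K)} = w.asIdeal :=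
    hmax.eq_of_le w.isPrime.ne_top ((Ideal.span_singleton_le_iff_mem _).mpr hw)
  exact HeightOneSpectrum.ext (h1.symm.trans h2)

variable {Dt : ModularParametrizationData W (W.conductorNorm ℤ)} {β : ℤ} {ι : K →+* ℂ}

/-! ### The change of level: `ι_* c_k(Q) = c_{k+u}(P_s)` -/

omit [W.IsGloballyMinimal] in
/-- **`ι_* c_k(Q) = c_{k+u}(P_s)` for a `p^u`-th root `Q ∈ E(K[s])` of the derived point** (the same
McCallum cocycle; corner-p1's `torsionH1OfDvd_kolyvaginClass_of_zsmul` on the Kolyvagin–Heegner datum,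
with the admissibility of `E(K[s]) ⊆ E(K̄)` for `p^{k+u}` supplied from `ρ̄_{E,p}` onto).
[cite: McCallumLMS1991, §4 Lemma 4.1, (6), Lemma 4.6] [cite: GrossLMS1991, §4 (4.4), (4.6)] -/
theorem torsionH1OfDvd_rootClass (hK : IsImaginaryQuadratic K) {p : ℕ} (hp : p.Prime) (hp2 : p ≠ 2)
    (hρ : W.HasSurjectiveModNGaloisRep p) {s : ℕ} (hs : s ≠ 0) (d : KolyvaginHeegnerData Dt β ι s)
    (k u : ℕ) (Q : (W.baseChange (ringClassField K ι s)).toAffine.Point)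
    (hAk : IsAdmissible (absoluteGaloisGroup K) d.pointsSubgroup ((p ^ k : ℕ) : ℤ))
    (hQ : d.toGeomPoints Q ∈ invPoints (absoluteGaloisGroup K) d.pointsSubgroup ((p ^ k : ℕ) : ℤ))
    (hQP : ((p ^ u : ℕ) : ℤ) • Q = d.derivedPoint)
    (hP : d.toGeomPoints d.derivedPoint ∈
      invPoints (absoluteGaloisGroup K) d.pointsSubgroup ((p ^ (k + u) : ℕ) : ℤ)) :
    WeierstrassCurve.torsionH1OfDvd (W.baseChange K)
        (show ((p ^ k : ℕ) : ℤ) ∣ ((p ^ (k + u) : ℕ) : ℤ) by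
          exact_mod_cast pow_dvd_pow p (Nat.le_add_right k u))
        (kolyvaginClass (W.baseChange K) ((p ^ k : ℕ) : ℤ)
          ((W.baseChange K).zsmul_geomPoints_surjective_of_charZero
            (by exact_mod_cast pow_ne_zero k hp.ne_zero)) hAk (d.toGeomPoints Q) hQ) =
      d.kolyvaginClass hp (k + u) := by
  have hA : IsAdmissible (absoluteGaloisGroup K) d.pointsSubgroup ((p ^ (k + u) : ℕ) : ℤ) :=
    RingClassNoTorsion.isAdmissible_pointsSubgroup _ hK hs hp hp2 hρ (k + u)
  rw [d.kolyvaginClass_of_admissible hp (k + u) hA hP]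
  refine X11b.Three.Koly.torsionH1OfDvd_kolyvaginClass_of_zsmul
    (W.baseChange K) _ (m := ((p ^ u : ℕ) : ℤ)) ?_ _ _ hAk hA hQ ?_ hP
  · push_cast; ring
  · rw [← map_zsmul, hQP]

/-! ### Kummer places for the root classes -/

omit [W.IsGloballyMinimal] in
/-- **The root class `c_k(Q)` is KUMMER wherever `c_{k+u}(P_s)` is**: the local Kummer kernel is
cartesian under the change of level `ι_*` (`mem_selmerLocalKer_iff_torsionH1OfDvd_mem`) and
`ι_* c_k(Q) = c_{k+u}(P_s)`. [cite: McCallumLMS1991, §4 Lemma 4.3, Lemma 4.6]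
[cite: SilvermanAEC2009, X.§4 (Remark 4.1.1)] -/
theorem localization_rootClass_mem_kummer (hK : IsImaginaryQuadratic K) {p : ℕ} (hp : p.Prime)
    (hp2 : p ≠ 2) (hρ : W.HasSurjectiveModNGaloisRep p) {s : ℕ} (hs : s ≠ 0)
    (d : KolyvaginHeegnerData Dt β ι s) (k u : ℕ) (Q : (W.baseChange (ringClassField K ι s)).toAffine.Point)
    (hAk : IsAdmissible (absoluteGaloisGroup K) d.pointsSubgroup ((p ^ k : ℕ) : ℤ))
    (hQ : d.toGeomPoints Q ∈ invPoints (absoluteGaloisGroup K) d.pointsSubgroup ((p ^ k : ℕ) : ℤ))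
    (hQP : ((p ^ u : ℕ) : ℤ) • Q = d.derivedPoint)
    (hP : d.toGeomPoints d.derivedPoint ∈
      invPoints (absoluteGaloisGroup K) d.pointsSubgroup ((p ^ (k + u) : ℕ) : ℤ))
    (v : Place K)
    (hv : galoisCohomology.localization ((W.baseChange K).torsionGaloisModule ((p ^ (k + u) : ℕ) : ℤ)) v 1
        (d.kolyvaginClass hp (k + u)) ∈
      (W.baseChange K).kummerSelmerStructure ((p ^ (k + u) : ℕ) : ℤ) v) :
    galoisCohomology.localization ((W.baseChange K).torsionGaloisModule ((p ^ k : ℕ) : ℤ)) v 1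
        (kolyvaginClass (W.baseChange K) ((p ^ k : ℕ) : ℤ)
          ((W.baseChange K).zsmul_geomPoints_surjective_of_charZero
            (by exact_mod_cast pow_ne_zero k hp.ne_zero)) hAk (d.toGeomPoints Q) hQ) ∈
      (W.baseChange K).kummerSelmerStructure ((p ^ k : ℕ) : ℤ) v := by
  have hdn : ((p ^ k : ℕ) : ℤ) ∣ ((p ^ (k + u) : ℕ) : ℤ) := by
    exact_mod_cast pow_dvd_pow p (Nat.le_add_right k u)
  have key : WeierstrassCurve.torsionH1OfDvd (W.baseChange K) hdn
      (kolyvaginClass (W.baseChange K) ((p ^ k : ℕ) : ℤ)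
        ((W.baseChange K).zsmul_geomPoints_surjective_of_charZero
          (by exact_mod_cast pow_ne_zero k hp.ne_zero)) hAk (d.toGeomPoints Q) hQ) ∈
      selmerLocalKer (W.baseChange K) (Place.Completion v) ((p ^ (k + u) : ℕ) : ℤ) := by
    rw [torsionH1OfDvd_rootClass W hK hp hp2 hρ hs d k u Q hAk hQ hQP hP,
      ← (W.baseChange K).comap_localization_kummerSelmerStructure]
    exact hv
  rw [← AddSubgroup.mem_comap, (W.baseChange K).comap_localization_kummerSelmerStructure]
  exact (Summit.BirchSwinnertonDyer.BirchSwinnertonDyer.Theorems.mem_selmerLocalKer_iff_torsionH1OfDvd_mem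
    (W.baseChange K) (Place.Completion v) hdn _).mpr key

/-! ### `hselmer` at one conductor and one root -/

variable {p : ℕ} [Fact p.Prime] {k : ℕ} [∀ j : ℕ, NumberField (ringClassField K ι j)]
  {𝒯 : SelmerStructure ((W.baseChange K).torsionGaloisModule ((p ^ k : ℕ) : ℤ))}
  (h𝒯 : ∀ v : HeightOneSpectrum (𝓞 K), 𝒯 (Sum.inr v) =
    ⨅ (ℓ : ℕ) (_ : ℓ.Prime ∧ (ℓ : 𝓞 K) ∈ v.asIdeal),
      ⨅ (w' : HeightOneSpectrum (𝓞 (ringClassField K ι ℓ)))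
        (_ : w'.asIdeal.LiesOver v.asIdeal),
        letI := (adicCompletionOfLiesOver K (ringClassField K ι ℓ) v w').toAlgebra
        transverseSubgroup (GaloisRep.toLocal v ((W.baseChange K).torsionGaloisModule ((p ^ k : ℕ) : ℤ)))
          (w'.adicCompletion (ringClassField K ι ℓ)))

include h𝒯 in
/-- **The supply's `hselmer` at one conductor: the class of a `p^u`-th root `Q` of `P_s` lies in
`H_{𝓕(s)} = (selmerF W p^k 𝒯 (placesDividing K s)).selmerGroup`** ([J] §3.1 item 7 with Prop. 4.5–4.6),
for the GLOBAL transverse family — GIVEN [GZ86 III (3.1)] in the receptacle form (`hGZ`, with `n'`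
prime to `p`), the transverse condition of the root class at the primes of `s` (`htr`, completion-layer
gap), and the invariance of `[P_s]` mod `p^{k+u}` (`hP`; from data at the divisors of `s`,
`KolyCert.toGeomPoints_derivedPoint_mem_invPoints_of_dvd_zhang`). Kummer places by the change of level
and Gross Prop. 6.2 (1); transverse places by the reconciliation of the global family.
[cite: Jetchev2008, §3.1 item 7 (p. 817), Prop. 4.5–4.6 (pp. 819–820)] [cite: GrossLMS1991, §6 Prop. 6.2 (1)]
[cite: GrossZagier1986, III (3.1)] [cite: Howard2004HeegnerKolyvagin, Lemma 2.7.3] -/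
theorem rootClass_mem_selmerGroup_selmerF (hK : IsImaginaryQuadratic K)
    (hD3 : NumberField.discr K ≠ -3) (hD4 : NumberField.discr K ≠ -4)
    (hH : SatisfiesHeegnerHypothesis (W.conductorNorm ℤ) K) (hp2 : p ≠ 2)
    (hρ : W.HasSurjectiveModNGaloisRep p)
    {n' : ℤ} (hcop' : IsCoprime (p : ℤ) n')
    (hGZ : ∀ (m : ℕ) (dm : KolyvaginHeegnerData Dt β ι m)
      (γ : ringClassField K ι m ≃ₐ[ℚ] ringClassField K ι m), γ ∈ ringClassGal ι m →
      ∀ v : HeightOneSpectrum (𝓞 K), ¬ (W.baseChange K).HasGoodReductionAt v →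
        n' • pointsMap (W.baseChange K) (v.adicCompletion K)
            (dm.toGeomPoints (pointGalHom W (ringClassField K ι m) γ dm.y)) ∈
          E0Receptacle (W.baseChange K) v ∧
        ∀ (ℓ : ℕ), ℓ ∈ m.primeFactors → ∀ (dm' : KolyvaginHeegnerData Dt β ι (m / ℓ))
          (hle : ringClassField K ι (m / ℓ) ≤ ringClassField K ι m),
          n' • pointsMap (W.baseChange K) (v.adicCompletion K)
              (dm.toGeomPoints (pointGalHom W (ringClassField K ι m) γ
                (WeierstrassCurve.Affine.Point.map (W' := W)
                  ((RingClassField.inclusion ι hle).restrictScalars ℚ) dm'.y))) ∈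
            E0Receptacle (W.baseChange K) v)
    {s : ℕ} (hs : Squarefree s) {u : ℕ}
    (hsK : ∀ ℓ ∈ s.primeFactors, Zhang2014.IsKolyvaginPrime (W.conductorNorm ℤ) W K p ℓ ∧
      k + u ≤ Zhang2014.kolyvaginIndex W p ℓ)
    (d : KolyvaginHeegnerData Dt β ι s) (Q : (W.baseChange (ringClassField K ι s)).toAffine.Point)
    (hAk : IsAdmissible (absoluteGaloisGroup K) d.pointsSubgroup ((p ^ k : ℕ) : ℤ))
    (hQ : d.toGeomPoints Q ∈ invPoints (absoluteGaloisGroup K) d.pointsSubgroup ((p ^ k : ℕ) : ℤ))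
    (hQP : ((p ^ u : ℕ) : ℤ) • Q = d.derivedPoint)
    (hP : d.toGeomPoints d.derivedPoint ∈
      invPoints (absoluteGaloisGroup K) d.pointsSubgroup ((p ^ (k + u) : ℕ) : ℤ))
    (htr : ∀ ℓ ∈ s.primeFactors,
      (kolyvaginClass (W.baseChange K) ((p ^ k : ℕ) : ℤ)
          ((W.baseChange K).zsmul_geomPoints_surjective_of_charZero
            (by exact_mod_cast pow_ne_zero k (Fact.out : p.Prime).ne_zero)) hAk (d.toGeomPoints Q) hQ) ∈
        transverseKer W K ι ((p ^ k : ℕ) : ℤ) ℓ) :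
    (kolyvaginClass (W.baseChange K) ((p ^ k : ℕ) : ℤ)
        ((W.baseChange K).zsmul_geomPoints_surjective_of_charZero
          (by exact_mod_cast pow_ne_zero k (Fact.out : p.Prime).ne_zero)) hAk (d.toGeomPoints Q) hQ) ∈
      (selmerF W ((p ^ k : ℕ) : ℤ) 𝒯 (placesDividing K s)).selmerGroup := by
  have hp : p.Prime := Fact.out
  have hs0 : s ≠ 0 := hs.ne_zero
  -- Kummer condition at every place not over a prime of `s`, at level `k + u`, then pulled back
  have hKum : ∀ v : Place K, (∀ ℓ ∈ s.primeFactors, ¬ PlaceOver K v ℓ) →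
      galoisCohomology.localization ((W.baseChange K).torsionGaloisModule ((p ^ k : ℕ) : ℤ)) v 1
        (kolyvaginClass (W.baseChange K) ((p ^ k : ℕ) : ℤ)
          ((W.baseChange K).zsmul_geomPoints_surjective_of_charZero
            (by exact_mod_cast pow_ne_zero k hp.ne_zero)) hAk (d.toGeomPoints Q) hQ) ∈
        (W.baseChange K).kummerSelmerStructure ((p ^ k : ℕ) : ℤ) v := by
    intro v hv
    refine localization_rootClass_mem_kummer W hK hp hp2 hρ hs0 d k u Q hAk hQ hQP hP v ?_
    exact localization_kolyvaginClass_mem_kummerSelmerStructure_of_GZ31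
      (phi_heegnerPointOfConductor_mem_range_map_ringClassField_holds (W.conductorNorm ℤ) W K)
      (exists_generator_ringClassGalOver_holds (K := K)) hK hD3 hD4 hH hp2 hρ Dt β ι hcop' hGZ hs hsK d v hv
  exact (mem_selmerGroup_selmerF_iff W _ 𝒯 hs0 _).mpr ⟨hKum, (globalTransverse_mem_iff h𝒯 hs _).mpr htr⟩

/-! ### Membership in `H_{𝓕₀(c)^λ}` from local memberships (sign-free) -/

omit [W.IsElliptic] [W.IsGloballyMinimal] [NeZero (W.conductorNorm ℤ)] [Fact p.Prime]
  [∀ j : ℕ, NumberField (ringClassField K ι j)] in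
/-- **`x ∈ H_{𝓕₀(c)^λ}` place by place** (bsd-jet's `mem_signPart_relaxedAt_selmerF0` without the
sign): Kummer off `c`, the carrier and `λ`; `𝒮` at the carrier places; `𝒯` at the places of `c`;
nothing at `λ`. [cite: Jetchev2008, §3.3.2, §3.4.1 (p. 816), Prop. 4.9 (p. 820)] -/
theorem mem_relaxedAt_selmerF0_of_local (n : ℤ)
    (𝒯' 𝒮 : SelmerStructure ((W.baseChange K).torsionGaloisModule n))
    {c : ℕ} (hc : c ≠ 0) (Qcar : Finset (HeightOneSpectrum (𝓞 K))) (v : HeightOneSpectrum (𝓞 K))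
    (x : galoisCohomology ((W.baseChange K).torsionGaloisModule n) 1)
    (hKum : ∀ w : Place K, (∀ ℓ ∈ c.primeFactors, ¬ PlaceOver K w ℓ) → w ≠ Sum.inr v →
      (∀ q ∈ Qcar, w ≠ Sum.inr q) →
      galoisCohomology.localization ((W.baseChange K).torsionGaloisModule n) w 1 x ∈
        (W.baseChange K).kummerSelmerStructure n w)
    (hstr : ∀ q ∈ Qcar, q ≠ v →
      galoisCohomology.localization ((W.baseChange K).torsionGaloisModule n) (Sum.inr q) 1 x ∈
        𝒮 (Sum.inr q))
    (htr : ∀ w ∈ placesDividing K c, w ∉ Qcar → w ≠ v →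
      galoisCohomology.localization ((W.baseChange K).torsionGaloisModule n) (Sum.inr w) 1 x ∈
        𝒯' (Sum.inr w)) :
    x ∈ ((selmerF0 W n 𝒯' 𝒮 (placesDividing K c) Qcar).relaxedAt {v}).selmerGroup := by
  rw [SelmerStructure.mem_selmerGroup_iff]
  intro w
  rcases w with w | q
  · -- infinite place: Kummer
    simp only [SelmerStructure.relaxedAt, SelmerStructure.modify_inl, SelmerVocabulary.selmerF0_inl,
      SelmerVocabulary.selmerF_inl]
    exact hKum (Sum.inl w) (fun ℓ _ ⟨_, h, _⟩ ↦ by cases h) (by simp) (fun q _ ↦ by simp)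
  · by_cases hqv : q = v
    · subst hqv
      simp [SelmerStructure.relaxedAt]
    rw [SelmerStructure.relaxedAt, SelmerStructure.modify_inr, if_neg (by simpa using hqv),
      if_neg (Finset.notMem_empty q), if_neg (Finset.notMem_empty q), SelmerVocabulary.selmerF0_inr]
    by_cases hqQ : q ∈ Qcar
    · rw [if_pos hqQ]; exact hstr q hqQ hqv
    rw [if_neg hqQ, SelmerVocabulary.selmerF_inr]
    by_cases hqS : q ∈ placesDividing K c
    · rw [if_pos hqS]; exact htr q hqS hqQ hqv
    rw [if_neg hqS]
    refine hKum (Sum.inr q) (fun ℓ hℓ hP ↦ ?_) (by simpa using hqv) (fun q' hq' h ↦ hqQ ?_)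
    · obtain ⟨w, hw, hvw⟩ := (SelmerVocabulary.exists_placeOver_iff hc (Sum.inr q)).mp ⟨ℓ, hℓ, hP⟩
      cases hvw
      exact hqS hw
    · cases h; exact hq'

/-! ### `hsel0` at one pair `(s, sℓ)` -/

include h𝒯 in
/-- **The supply's `hsel0` at one step: `c_k(sℓ) ∈ H_{𝓕₀(s)^λ}`** (Jetchev Prop. 4.6 ∕ 4.9, sign-free:
Kummer off `sℓ` and the carrier, transverse at the primes of `s`, the family `𝒮` at the carrier
places `Q`, nothing at the prime `λ` over `ℓ`), for the GLOBAL transverse family — GIVEN [GZ86 III (3.1)]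
(`hGZ`), the transverse condition of `c_k(sℓ)` at the primes of `s` (`htr`, gap) and its membership in
`𝒮` at the carrier places (`h𝒮Q`: bsd-jet's gap `h49str` for the stringent family, or the Kummer case).
[cite: Jetchev2008, Prop. 4.6, Prop. 4.9 (pp. 819–820)] [cite: GrossLMS1991, §6 Prop. 6.2 (1)]
[cite: GrossZagier1986, III (3.1)] [cite: Howard2004HeegnerKolyvagin, Lemma 2.7.3] -/
theorem kolyvaginClass_mem_selmerGroup_selmerF0_relaxedAt (hK : IsImaginaryQuadratic K)
    (hD3 : NumberField.discr K ≠ -3) (hD4 : NumberField.discr K ≠ -4)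
    (hH : SatisfiesHeegnerHypothesis (W.conductorNorm ℤ) K) (hp2 : p ≠ 2)
    (hρ : W.HasSurjectiveModNGaloisRep p)
    {n' : ℤ} (hcop' : IsCoprime (p : ℤ) n')
    (hGZ : ∀ (m : ℕ) (dm : KolyvaginHeegnerData Dt β ι m)
      (γ : ringClassField K ι m ≃ₐ[ℚ] ringClassField K ι m), γ ∈ ringClassGal ι m →
      ∀ v : HeightOneSpectrum (𝓞 K), ¬ (W.baseChange K).HasGoodReductionAt v →
        n' • pointsMap (W.baseChange K) (v.adicCompletion K)
            (dm.toGeomPoints (pointGalHom W (ringClassField K ι m) γ dm.y)) ∈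
          E0Receptacle (W.baseChange K) v ∧
        ∀ (ℓ : ℕ), ℓ ∈ m.primeFactors → ∀ (dm' : KolyvaginHeegnerData Dt β ι (m / ℓ))
          (hle : ringClassField K ι (m / ℓ) ≤ ringClassField K ι m),
          n' • pointsMap (W.baseChange K) (v.adicCompletion K)
              (dm.toGeomPoints (pointGalHom W (ringClassField K ι m) γ
                (WeierstrassCurve.Affine.Point.map (W' := W)
                  ((RingClassField.inclusion ι hle).restrictScalars ℚ) dm'.y))) ∈
            E0Receptacle (W.baseChange K) v)
    (𝒮 : SelmerStructure ((W.baseChange K).torsionGaloisModule ((p ^ k : ℕ) : ℤ)))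
    (Qcar : Finset (HeightOneSpectrum (𝓞 K)))
    {s : ℕ} (hs : Squarefree s)
    (hsK : ∀ q ∈ s.primeFactors, Zhang2014.IsKolyvaginPrime (W.conductorNorm ℤ) W K p q ∧
      k ≤ Zhang2014.kolyvaginIndex W p q)
    {ℓ : ℕ} (hℓK : Zhang2014.IsKolyvaginPrime (W.conductorNorm ℤ) W K p ℓ)
    (hkℓ : k ≤ Zhang2014.kolyvaginIndex W p ℓ) (hℓs : ¬ ℓ ∣ s)
    {m : ℕ} (hm : m = s * ℓ) (d' : KolyvaginHeegnerData Dt β ι m)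
    (v : HeightOneSpectrum (𝓞 K)) (hv : (ℓ : 𝓞 K) ∈ v.asIdeal)
    (htr : ∀ q ∈ s.primeFactors,
      (d'.kolyvaginClass (Fact.out : p.Prime) k :
        galoisCohomology ((W.baseChange K).torsionGaloisModule ((p ^ k : ℕ) : ℤ)) 1) ∈
        transverseKer W K ι ((p ^ k : ℕ) : ℤ) q)
    (h𝒮Q : ∀ q ∈ Qcar,
      galoisCohomology.localization ((W.baseChange K).torsionGaloisModule ((p ^ k : ℕ) : ℤ))
          (Sum.inr q) 1 (d'.kolyvaginClass (Fact.out : p.Prime) k) ∈ 𝒮 (Sum.inr q)) :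
    (d'.kolyvaginClass (Fact.out : p.Prime) k :
        galoisCohomology ((W.baseChange K).torsionGaloisModule ((p ^ k : ℕ) : ℤ)) 1) ∈
      (((selmerF0 W ((p ^ k : ℕ) : ℤ) 𝒯 𝒮 (placesDividing K s) Qcar).relaxedAt {v}).selmerGroup) := by
  have hp : p.Prime := Fact.out
  subst hm
  have hs0 : s ≠ 0 := hs.ne_zero
  have hℓ : ℓ.Prime := hℓK.1
  -- the conductor `sℓ`
  have hcop : (ℓ).Coprime s := (Nat.Prime.coprime_iff_not_dvd hℓ).mpr hℓs
  have hsl : Squarefree (s * ℓ) := (Nat.squarefree_mul hcop.symm).mpr ⟨hs, hℓ.squarefree⟩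
  have hpf : (s * ℓ).primeFactors = s.primeFactors ∪ {ℓ} := by
    rw [Nat.primeFactors_mul hs0 hℓ.ne_zero, hℓ.primeFactors]
  have hslK : ∀ q ∈ (s * ℓ).primeFactors, Zhang2014.IsKolyvaginPrime (W.conductorNorm ℤ) W K p q ∧
      k ≤ Zhang2014.kolyvaginIndex W p q := by
    intro q hq
    rw [hpf, Finset.mem_union, Finset.mem_singleton] at hq
    rcases hq with h | rfl
    · exact hsK q h
    · exact ⟨hℓK, hkℓ⟩
  -- Kummer condition at every place not over a prime of `sℓ`
  have hKum : ∀ w : Place K, (∀ q ∈ (s * ℓ).primeFactors, ¬ PlaceOver K w q) →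
      galoisCohomology.localization ((W.baseChange K).torsionGaloisModule ((p ^ k : ℕ) : ℤ)) w 1
        (d'.kolyvaginClass hp k) ∈
        (W.baseChange K).kummerSelmerStructure ((p ^ k : ℕ) : ℤ) w := fun w hw ↦
    localization_kolyvaginClass_mem_kummerSelmerStructure_of_GZ31
      (phi_heegnerPointOfConductor_mem_range_map_ringClassField_holds (W.conductorNorm ℤ) W K)
      (exists_generator_ringClassGalOver_holds (K := K)) hK hD3 hD4 hH hp2 hρ Dt β ι hcop' hGZ hsl hslK d' w hw
  refine mem_relaxedAt_selmerF0_of_local W _ 𝒯 𝒮 hs0 Qcar v _ (fun w hws hwv _ ↦ hKum w ?_)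
    (fun q hq _ ↦ h𝒮Q q hq) (fun w hw _ _ ↦ (globalTransverse_mem_iff h𝒯 hs _).mpr htr w hw)
  -- a place not over `s` and not `λ` is not over `sℓ`
  intro q hq hPO
  rw [hpf, Finset.mem_union, Finset.mem_singleton] at hq
  rcases hq with h | rfl
  · exact hws q h hPO
  · obtain ⟨w', hww, hw'⟩ := hPO
    subst hww
    exact hwv (congrArg Sum.inr (place_eq_of_natCast_mem_of_isPrime hℓ.ne_zero hℓK.2.2.2.2.1 w' v hw' hv))

end Summit.BirchSwinnertonDyer.Rank1Residual.JET.Walk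

end
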